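import Summits.CriticalPhenomena.CardyFormulaZ2.Theorems.CardyBondTriangularBondTriangularCardyKiteBReverse
import HarnessLib

/-!
# Route CardyBondTriangular · crux `BondTriangularCardy` · line `birth`: following the kite interface — a blue arm or a cycle

Helper of the stub `stub_blueArm`. The walk of the kite interface (`…KiteBDarts`, `…KiteBStep`,
`…KiteBReverse`) from an admissible interface dart `s₀` whose left cell is a hexagon of `G`, stopped
when the left cell of the next dart leaves `G`: a partial injective map on the finite set of
admissible interface darts with left cell in `G`, so (Bollobás–Riordan, *Percolation* (2006),
Ch. 7, p. 178: "Suppose first that the component of `I` containing `f` is a path … Suppose next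
that [it] is a cycle") **either** the walk stops — the left cells, a chain of hexagons of `G`
successively equal or blue-adjacent (`clBlueGraph`), have reached the arc `A₀`
(`leftCell_mem_arc_zero_of_next_out`) — **or** it comes back to `s₀`, every dart before being an
admissible interface dart with left cell in `G`, blue-joined to the left cell of `s₀`
(`blueArm_or_cycle`). Adapted from `TriIfaceOrbit3.closedArm_or_cycle₃`.

## References

* B. Bollobás, O. Riordan, *Percolation*, CUP (2006), Ch. 7, Claim 10 p. 178.
-/

namespace Summit.CriticalPhenomena.CardyFormulaZ2.Theorems.BondTriangularCardyLine.KiteB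

open Literature.Probability.Percolation Literature.Probability.LatticeModels

section Orbit

/-- **Blue adjacency from blue kites at a common corner**, for hexagons of `G` (registered
anchor of this file). -/
theorem clBlueGraph_adj_of_ccol : ∀ {D : Literature.Probability.Percolation.TriMarkedDomain 3} {σ : Literature.Probability.Percolation.CLHexConfig} {x y : Literature.Probability.LatticeModels.Site 2}, x ∈ D.verts → y ∈ D.verts → Literature.Probability.LatticeModels.triGraph.Adj x y → ∀ {G : Literature.Probability.LatticeModels.HexVertex}, x ∈ Literature.Probability.LatticeModels.hexFaceVertices G → y ∈ Literature.Probability.LatticeModels.hexFaceVertices G → Summit.CriticalPhenomena.CardyFormulaZ2.Theorems.BondTriangularCardyLine.KiteB.ccol D σ x G = false → Summit.CriticalPhenomena.CardyFormulaZ2.Theorems.BondTriangularCardyLine.KiteB.ccol D σ y G = false → (Literature.Probability.Percolation.clBlueGraph σ).Adj x y := by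
  intro D σ x y hx hy hadj G hxG hyG cx cy
  rw [ccol_of_mem hx hxG] at cx
  rw [ccol_of_mem hy hyG] at cy
  simp only [decide_eq_false_iff_not] at cx cy
  exact (clBlueGraph_adj_iff σ x y).2 ⟨hadj, G, hxG, hyG, cx, cy⟩

variable {D : TriMarkedDomain 3} {σ : CLHexConfig}

/-- **Following the kite interface from an interface dart with left cell in `G`: a blue arm to
`A₀`, or a cycle.** The walk `partialOrbit step s₀` of the stopped successor
`step d = some (succ d)` if the left cell of `succ d` is in `G`, `none` otherwise: either it
ends at a dart whose left cell lies on the arc `A₀`, blue-joined (in `clBlueGraph σ`) to the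
left cell of the start; or it returns to the start after `N ≥ 1` steps, all darts before being
admissible interface darts with left cell in `G`, each followed by its successor, their left
cells blue-joined to that of the start. -/
theorem blueArm_or_cycle {s₀ : KDart} (h₀ : iface (kcol D σ) s₀ = true) (hadm₀ : s₀.adm = true)
    (hG₀ : s₀.leftCell ∈ D.verts) :
    (∃ n, (clBlueGraph σ).Reachable s₀.leftCell
        (partialOrbit (fun d => if (succ (kcol D σ) d).leftCell ∈ D.verts then some (succ (kcol D σ) d) else none) s₀ n).leftCell ∧
      (partialOrbit (fun d => if (succ (kcol D σ) d).leftCell ∈ D.verts then some (succ (kcol D σ) d) else none) s₀ n).leftCell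
        ∈ D.arc 0) ∨
      (∃ N, 0 < N ∧
        partialOrbit (fun d => if (succ (kcol D σ) d).leftCell ∈ D.verts then some (succ (kcol D σ) d) else none) s₀ N = s₀ ∧
        ∀ k < N,
          iface (kcol D σ) (partialOrbit (fun d => if (succ (kcol D σ) d).leftCell ∈ D.verts then some (succ (kcol D σ) d) else none) s₀ k) = true ∧
          (partialOrbit (fun d => if (succ (kcol D σ) d).leftCell ∈ D.verts then some (succ (kcol D σ) d) else none) s₀ k).adm = true ∧
          (partialOrbit (fun d => if (succ (kcol D σ) d).leftCell ∈ D.verts then some (succ (kcol D σ) d) else none) s₀ k).leftCell ∈ D.verts ∧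
          succ (kcol D σ) (partialOrbit (fun d => if (succ (kcol D σ) d).leftCell ∈ D.verts then some (succ (kcol D σ) d) else none) s₀ k) =
            partialOrbit (fun d => if (succ (kcol D σ) d).leftCell ∈ D.verts then some (succ (kcol D σ) d) else none) s₀ (k + 1) ∧
          (clBlueGraph σ).Reachable s₀.leftCell
            (partialOrbit (fun d => if (succ (kcol D σ) d).leftCell ∈ D.verts then some (succ (kcol D σ) d) else none) s₀ k).leftCell) := by
  -- adapted from `TriIfaceOrbit3.closedArm_or_cycle₃` (site version)
  classical
  set g : KDart → Option KDart := fun d => if (succ (kcol D σ) d).leftCell ∈ D.verts then some (succ (kcol D σ) d) else none with hg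
  set orb := partialOrbit g s₀ with horbdef
  have hsome : ∀ {d d'}, g d = some d' → succ (kcol D σ) d = d' ∧ d'.leftCell ∈ D.verts := by
    intro d d' h
    simp only [hg] at h
    split_ifs at h with hc
    · cases h; exact ⟨rfl, hc⟩
  have hnone : ∀ {d}, g d = none → (succ (kcol D σ) d).leftCell ∉ D.verts := by
    intro d h
    simp only [hg] at h
    split_ifs at h with hc
    exact hc
  obtain ⟨S₀, hS₀⟩ := exists_finset_of_darts D
  set S := S₀.filter fun d => iface (kcol D σ) d = true ∧ d.adm = true ∧ d.leftCell ∈ D.verts with hS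
  have hmemS : ∀ {d}, d ∈ S ↔ iface (kcol D σ) d = true ∧ d.adm = true ∧ d.leftCell ∈ D.verts := by
    intro d
    rw [hS, Finset.mem_filter]
    exact ⟨fun h => h.2, fun h => ⟨hS₀ d h.2.1 h.2.2, h⟩⟩
  have h₀S : s₀ ∈ S := hmemS.2 ⟨h₀, hadm₀, hG₀⟩
  have hcl : ∀ x ∈ S, ∀ y, g x = some y → y ∈ S := by
    intro x hx y hy
    obtain ⟨hi, ha, hl⟩ := hmemS.1 hx
    obtain ⟨rfl, hl'⟩ := hsome hy
    exact hmemS.2 ⟨iface_succ hi ha hl, adm_succ _ ha, hl'⟩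
  have hinj : ∀ x ∈ S, ∀ x' ∈ S, ∀ y, g x = some y → g x' = some y → x = x' := by
    intro x hx x' hx' y hy hy'
    obtain ⟨hi, ha, hl⟩ := hmemS.1 hx
    obtain ⟨hi', ha', hl'⟩ := hmemS.1 hx'
    exact succ_inj_of_iface hi ha hl hi' ha' hl' ((hsome hy).1.trans (hsome hy').1.symm)
  have inv : ∀ n, (∀ k < n, g (orb k) = some (orb (k + 1))) → ∀ k ≤ n,
      orb k ∈ S ∧ (clBlueGraph σ).Reachable s₀.leftCell (orb k).leftCell := by
    intro n hdef k
    induction k with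
    | zero => intro; exact ⟨h₀S, SimpleGraph.Reachable.refl _⟩
    | succ k ih =>
      intro hk
      obtain ⟨hkS, hreach⟩ := ih (by omega)
      obtain ⟨hi, ha, hl⟩ := hmemS.1 hkS
      have hstep := hdef k (by omega)
      obtain ⟨hsucc, hl'⟩ := hsome hstep
      refine ⟨hcl _ hkS _ hstep, hreach.trans ?_⟩
      rw [← hsucc]
      rcases leftCell_succ hi ha with h | ⟨hadj, G, m1, m2, c1, c2⟩
      · rw [h]
      · exact (clBlueGraph_adj_of_ccol hl (hsucc ▸ hl') hadj m1 m2 c1 c2).reachable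
  rcases TriMarkedDomain.exists_partialOrbit_end_or_return g S s₀ h₀S hcl hinj with ⟨n, hdef, hend⟩ | ⟨N, hN, hdef, hret⟩
  · left
    obtain ⟨hnS, hreach⟩ := inv n hdef n le_rfl
    obtain ⟨hi, ha, hl⟩ := hmemS.1 hnS
    exact ⟨n, hreach, leftCell_mem_arc_zero_of_next_out hi ha hl (hnone hend)⟩
  · right
    refine ⟨N, hN, hret, fun k hk => ?_⟩
    obtain ⟨hkS, hreach⟩ := inv N hdef k hk.le
    obtain ⟨hi, ha, hl⟩ := hmemS.1 hkS
    exact ⟨hi, ha, hl, (hsome (hdef k hk)).1, hreach⟩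

end Orbit

end Summit.CriticalPhenomena.CardyFormulaZ2.Theorems.BondTriangularCardyLine.KiteB
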